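import Mathlib
import HarnessLib
import Summits.HubbardSuperconductivity.HubbardSuperconductivity.Theorems.KLProgrammeKLRegimeSplitTwoLegCoreTFromExports
import Summits.HubbardSuperconductivity.HubbardSuperconductivity.Theorems.KLProgrammeKLRegimeEngineV8DefsQ3
import Summits.HubbardSuperconductivity.HubbardSuperconductivity.Theorems.KLProgrammeFermiSurfaceBandConstants

/-!
# Route `KLProgramme` — gen-5 ENGINE child 19918, two-leg stubs: the two-leg closers under NAMED thresholds (`klCurveC3 R`, `klCurveU0 R`), and
# the compatibility `klEngC₃3 P R ≤ klCurveC3 R`, `klEngU₀3 P R c ≤ klCurveU0 R` with the stub's binders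

Cell `gate-hubbard-kl`, seat p1b (g6).  The regime-keyed two-leg closers of this lineage (`twoLegSlopes_of_frameOK_regime`,
`frameLipschitzFnT_succ_of_increment_responses`, `twoLegCoreT_succ_of_position_exports`, …) quantify their thresholds EXISTENTIALLY (`∃ c₃ U₀`, from the
opaque `frame_thresholds`), so they cannot be invoked inside `stub_twoLeg_step` / `stub_twoLeg_scale0` of the 19918 skeleton, whose binders are the NAMED
numerals `c ≤ klEngC₃3 P R`, `U ≤ klEngU₀3 P R c`.  This file re-keys the (E3c) and (E3d/e) closers to k3c3-p3's named thresholds `klCurveC3 R`,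
`klCurveU0 R` (`frame_sizes_of_frameOK_explicit`, `frame_thresholds_explicit`, p486548) and proves that the stub's thresholds are below them:
* §0 `klCurveKappa_eq_fifth` (numerically `cDtmin(−1.1,−0.1) ≥ 0.33 > 1/5`, `klfs_cDtmin_ge`), `klEngC₃3_le_klCurveC3`, `klEngU₀3_le_klCurveU0`;
* §1 the WIDE band `(−1.2, −0.05)` of the slopes reading: `two_frameSize_lt_cDtmin_wide` (`2A ≤ 1/10 < 0.23 ≤ Dt_min(−1.2,−0.05)`);
* §2 `twoLegSlopes_of_position_moments_explicit` ((E3d/e) with `D_sl = cDtmin(−1.2,−0.05)/2`), `frameLipschitzFnT_succ_of_increment_responses_explicit`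
  and `frameLipschitzFnT_zero_of_responses_explicit` ((E3c) with `D_lip = klCurveD = cDtmin(−1.1,−0.1)/2`).
Proofs only; nothing about the model is asserted.  References: BGM 2006 §2.4 [cite: BenfattoGiulianiMastropietro2006].
-/

noncomputable section

namespace Summit.HubbardSuperconductivity.HubbardSuperconductivity.Theorems.KLRegimeSplit

set_option linter.dupNamespace false -- summit = problem name (single-conjunct summit), D-0017

open Real Finset
open Literature.MathematicalPhysics.QuantumLattice Literature.MathematicalPhysics.QuantumLattice.BandSectorCounting
open Literature.Probability.LatticeModels
open Summit.HubbardSuperconductivity.HubbardSuperconductivity.Theorems.DispersionFlow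
open Summit.HubbardSuperconductivity.HubbardSuperconductivity.Theorems.PerturbedFermiCurve
open Summit.HubbardSuperconductivity.HubbardSuperconductivity.Theorems.KLProgrammeLegKernels
open Summit.HubbardSuperconductivity.HubbardSuperconductivity.Theorems.TwoLegFourier
open Summit.HubbardSuperconductivity.HubbardSuperconductivity.Theorems.EngineV8

/-! ## §0 Numerics of the thresholds and compatibility with the engine package `klEngC₃3 / klEngU₀3` -/

/-- `Dt_min(−1.1, −0.1) ≥ 33/100` (from `klfs_cDtmin_ge`: `√0.39·√2.9/π`). -/
theorem cDtmin_window_ge : (33 : ℝ) / 100 ≤ cDtmin (-1.1) (-0.1) := by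
  have h := klfs_cDtmin_ge (a := (-1.1 : ℝ)) (b := (-0.1 : ℝ)) (by norm_num) (by norm_num)
  have h1 : (0.62 : ℝ) ≤ Real.sqrt (-(-0.1 : ℝ) * (4 + (-0.1))) := Real.le_sqrt_of_sq_le (by norm_num)
  have h2 : (1.7 : ℝ) ≤ Real.sqrt ((-1.1 : ℝ) + 4) := Real.le_sqrt_of_sq_le (by norm_num)
  have hπ := Real.pi_lt_d2
  have hπ0 := Real.pi_pos
  have h3 : (33 : ℝ) / 100 ≤ Real.sqrt (-(-0.1 : ℝ) * (4 + (-0.1))) * Real.sqrt ((-1.1 : ℝ) + 4) / π := by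
    rw [le_div_iff₀ hπ0]
    nlinarith [Real.sqrt_nonneg (-(-0.1 : ℝ) * (4 + (-0.1))), Real.sqrt_nonneg ((-1.1 : ℝ) + 4)]
  exact h3.trans h

/-- `Dt_min(−1.2, −0.05) ≥ 23/100` (the wide band of the slopes reading). -/
theorem cDtmin_wide_ge : (23 : ℝ) / 100 ≤ cDtmin (-1.2) (-0.05) := by
  have h := klfs_cDtmin_ge (a := (-1.2 : ℝ)) (b := (-0.05 : ℝ)) (by norm_num) (by norm_num)
  have h1 : (0.44 : ℝ) ≤ Real.sqrt (-(-0.05 : ℝ) * (4 + (-0.05))) := Real.le_sqrt_of_sq_le (by norm_num)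
  have h2 : (1.67 : ℝ) ≤ Real.sqrt ((-1.2 : ℝ) + 4) := Real.le_sqrt_of_sq_le (by norm_num)
  have hπ := Real.pi_lt_d2
  have hπ0 := Real.pi_pos
  have h3 : (23 : ℝ) / 100 ≤ Real.sqrt (-(-0.05 : ℝ) * (4 + (-0.05))) * Real.sqrt ((-1.2 : ℝ) + 4) / π := by
    rw [le_div_iff₀ hπ0]
    nlinarith [Real.sqrt_nonneg (-(-0.05 : ℝ) * (4 + (-0.05))), Real.sqrt_nonneg ((-1.2 : ℝ) + 4)]
  exact h3.trans h

/-- `κ = 1/5` (the `Dt_min` branch of the `min` is larger). -/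
theorem klCurveKappa_eq_fifth : klCurveKappa = 1 / 5 := by
  unfold klCurveKappa
  exact min_eq_right (by linarith [cDtmin_window_ge])

/-- **The engine package's regime threshold is below the curve threshold**: `klEngC₃3 P R ≤ klCurveC3 R`. -/
theorem klEngC₃3_le_klCurveC3 (P : SplitConsts) {R : RenConsts} (hR : ∀ j, 0 ≤ R.Gfr j) : klEngC₃3 P R ≤ klCurveC3 R := by
  unfold klEngC₃3 klCurveC3
  rw [klCurveKappa_eq_fifth]
  have hP := one_le_klEngPsq P
  have hRs : 1 + R.Gfr 2 ^ 2 ≤ klEngRsq R := by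
    unfold klEngRsq
    have : R.Gfr 2 ^ 2 ≤ ∑ j ∈ range 5, R.Gfr j ^ 2 :=
      Finset.single_le_sum (f := fun j => R.Gfr j ^ 2) (fun j _ => sq_nonneg _) (by simp)
    nlinarith [sq_nonneg R.cr, sq_nonneg R.cz]
  have hg := hR 2
  have hRs1 : 1 ≤ klEngRsq R := one_le_klEngRsq R
  have hden : 0 < (2 : ℝ) ^ 120 * klEngPsq P * klEngRsq R ^ 2 := by positivity
  rw [div_le_div_iff₀ hden (by positivity), one_mul]
  -- `12 (Gfr₂ + 1)/5 ≤ 2^120 · Psq · Rsq²`, since `Rsq² ≥ Rsq ≥ 1 + Gfr₂² ≥ (1 + Gfr₂)/2`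
  have h1 : (1 + R.Gfr 2) / 2 ≤ 1 + R.Gfr 2 ^ 2 := by nlinarith [sq_nonneg (R.Gfr 2 - 1 / 2)]
  have h2 : klEngRsq R ≤ klEngRsq R ^ 2 := by nlinarith
  have h3 : (2 : ℝ) ^ 120 * klEngPsq P * klEngRsq R ^ 2 ≥ (2 : ℝ) ^ 120 * (1 + R.Gfr 2 ^ 2) := by
    have : klEngPsq P * klEngRsq R ^ 2 ≥ 1 * (1 + R.Gfr 2 ^ 2) := mul_le_mul hP (hRs.trans h2) (by positivity) (by positivity)
    nlinarith
  have h4 : (2 : ℝ) ^ 120 ≥ 24 := by norm_num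
  nlinarith

/-- **The engine package's coupling threshold is below the curve threshold**: `klEngU₀3 P R c ≤ klCurveU0 R`. -/
theorem klEngU₀3_le_klCurveU0 (P : SplitConsts) {R : RenConsts} (hR : ∀ j, 0 ≤ R.Gfr j) (c : ℝ) : klEngU₀3 P R c ≤ klCurveU0 R := by
  unfold klEngU₀3 klCurveU0
  rw [klCurveKappa_eq_fifth]
  have hP := one_le_klEngPsq P
  have hRs1 : 1 ≤ klEngRsq R := one_le_klEngRsq R
  have hRs : 1 + R.Gfr 0 ^ 2 + R.Gfr 1 ^ 2 ≤ klEngRsq R := by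
    unfold klEngRsq
    have h0 : R.Gfr 0 ^ 2 + R.Gfr 1 ^ 2 ≤ ∑ j ∈ range 5, R.Gfr j ^ 2 := by
      rw [Finset.sum_range_succ, Finset.sum_range_succ, Finset.sum_range_succ, Finset.sum_range_succ, Finset.sum_range_one]
      nlinarith [sq_nonneg (R.Gfr 2), sq_nonneg (R.Gfr 3), sq_nonneg (R.Gfr 4)]
    nlinarith [sq_nonneg R.cr, sq_nonneg R.cz]
  have hg0 := hR 0; have hg1 := hR 1
  have hden : 0 < (2 : ℝ) ^ 120 * klEngPsq P ^ 2 * klEngRsq R ^ 4 * (c ^ 2 + 1) := by positivity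
  refine le_min ?_ ?_
  · rw [div_le_one hden]
    have : (1 : ℝ) ≤ klEngPsq P ^ 2 * klEngRsq R ^ 4 * (c ^ 2 + 1) := by
      have h1 : (1 : ℝ) ≤ klEngPsq P ^ 2 := one_le_pow₀ hP
      have h2 : (1 : ℝ) ≤ klEngRsq R ^ 4 := one_le_pow₀ hRs1
      have h3 : (1 : ℝ) ≤ c ^ 2 + 1 := by nlinarith [sq_nonneg c]
      calc (1 : ℝ) = 1 * 1 * 1 := by ring
        _ ≤ klEngPsq P ^ 2 * klEngRsq R ^ 4 * (c ^ 2 + 1) := by gcongr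
    nlinarith
  · rw [div_le_div_iff₀ hden (by positivity), one_mul]
    -- `24 (G₀ + G₁ + 1)/5 ≤ 2^120 · Psq² · Rsq⁴ · (c²+1)`, since `Rsq⁴ ≥ Rsq ≥ 1 + G₀² + G₁² ≥ (G₀ + G₁ + 1)/2`
    have h1 : (R.Gfr 0 + R.Gfr 1 + 1) / 2 ≤ 1 + R.Gfr 0 ^ 2 + R.Gfr 1 ^ 2 := by
      nlinarith [sq_nonneg (R.Gfr 0 - 1 / 2), sq_nonneg (R.Gfr 1 - 1 / 2)]
    have h2 : klEngRsq R ≤ klEngRsq R ^ 4 := by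
      calc klEngRsq R = klEngRsq R ^ 1 := (pow_one _).symm
        _ ≤ klEngRsq R ^ 4 := pow_le_pow_right₀ hRs1 (by norm_num)
    have h3 : (1 + R.Gfr 0 ^ 2 + R.Gfr 1 ^ 2) ≤ klEngPsq P ^ 2 * klEngRsq R ^ 4 * (c ^ 2 + 1) := by
      have hP2 : (1 : ℝ) ≤ klEngPsq P ^ 2 := one_le_pow₀ hP
      have hc2 : (1 : ℝ) ≤ c ^ 2 + 1 := by nlinarith [sq_nonneg c]
      calc (1 + R.Gfr 0 ^ 2 + R.Gfr 1 ^ 2) = 1 * (1 + R.Gfr 0 ^ 2 + R.Gfr 1 ^ 2) * 1 := by ring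
        _ ≤ klEngPsq P ^ 2 * klEngRsq R ^ 4 * (c ^ 2 + 1) :=
          mul_le_mul (mul_le_mul hP2 (hRs.trans h2) (by positivity) (by positivity)) hc2 (by positivity) (by positivity)
    have h4 : (2 : ℝ) ^ 120 ≥ 48 := by norm_num
    nlinarith

/-! ## §1 The wide band `(−1.2, −0.05)` of the slopes reading under the named thresholds -/

/-- Under `c ≤ klCurveC3 R`, `U ≤ klCurveU0 R`: the frame's `C²` size `A ≤ 1/20` and `2A < Dt_min(−1.2, −0.05)`, `Dt/2 ≤ Dt − 2A`. -/
theorem two_frameSize_lt_cDtmin_wide {R : RenConsts} (hR : ∀ j, 0 ≤ R.Gfr j) {c U : ℝ} (hc : 0 ≤ c) (hcle : c ≤ klCurveC3 R)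
    (hU : 0 < U) (hUle : U ≤ klCurveU0 R) :
    2 * R.Gfr 0 * |U| + 2 * R.Gfr 1 * U ^ 2 + R.Gfr 2 * (c / Real.log 4) ≤ 1 / 20 ∧
    2 * (2 * R.Gfr 0 * |U| + 2 * R.Gfr 1 * U ^ 2 + R.Gfr 2 * (c / Real.log 4)) < cDtmin (-1.2) (-0.05) ∧
    cDtmin (-1.2) (-0.05) / 2 ≤ cDtmin (-1.2) (-0.05) - 2 * (2 * R.Gfr 0 * |U| + 2 * R.Gfr 1 * U ^ 2 + R.Gfr 2 * (c / Real.log 4)) := by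
  have h4A := frame_thresholds_explicit hR hc hcle hU hUle
  rw [klCurveKappa_eq_fifth] at h4A
  have hw := cDtmin_wide_ge
  refine ⟨by linarith, by linarith, by linarith⟩

/-! ## §2 The (E3d/e) and (E3c) closers under the named thresholds -/

section Model

variable {L M : ℕ} [NeZero L] [NeZero M]

/-- **(E3d/e) from position moments, NAMED thresholds**: `c ≤ klCurveC3 R`, `U ≤ klCurveU0 R`, regime, `μ ∈ klWindowC`, `K` admissible; first spatial
moment `Mˢ` and temporal moment `Mᵗ` of `W^{(n)}` with `2Mˢ ≤ cz|U|·(Dt_min(−1.2,−0.05)/2)` and `2Mᵗ ≤ cz|U|` ⇒ `TwoLegSlopes … K n`. -/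
theorem twoLegSlopes_of_position_moments_explicit {R : RenConsts} (hR : ∀ j, 0 ≤ R.Gfr j) {c : ℝ} (hc : 0 < c) (hcle : c ≤ klCurveC3 R)
    {U : ℝ} (hU : 0 < U) (hUle : U ≤ klCurveU0 R) {β : ℝ} (hβmin : klBetaMin ≤ β) (hβc : β ≤ Real.exp (c / U ^ 2))
    {μ : ℝ} (hμ : μ ∈ klWindowC) {K : TrigPolyC4v} (hK : FrameOK R U (nScales β) μ K) (n : ℕ) {Ms Mt : ℝ} (hMs0 : 0 ≤ Ms)
    (hMs : ∀ (σ : Fin 2) (x₀ : SpaceTimeIdx L M), imagTimeWeight β M *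
      ∑ x ∈ (univ : Finset (Fin 2 → SpaceTimeIdx L M)).filter (fun x => x 0 = x₀),
        (1 + ((((x 1).2 - (x 0).2) 0).valMinAbs.natAbs : ℝ) + ((((x 1).2 - (x 0).2) 1).valMinAbs.natAbs : ℝ)) ^ 1 *
          ‖sectorisedKernel L M β (trivialMultiplier L M) (klEffectiveAction L M β U μ K klE0 n) 2
            (![((0, σ), 0), ((0, σ), 1)] : Fin 2 → SectorLeg 1) x‖ ≤ Ms)
    (hMt : ∀ (σ : Fin 2) (x₀ : SpaceTimeIdx L M), imagTimeWeight β M *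
      ∑ x ∈ (univ : Finset (Fin 2 → SpaceTimeIdx L M)).filter (fun x => x 0 = x₀),
        imagTimeWeight β M * (circDist (2 * M) (x 0).1.val (x 1).1.val : ℝ) *
          ‖sectorisedKernel L M β (trivialMultiplier L M) (klEffectiveAction L M β U μ K klE0 n) 2
            (![((0, σ), 0), ((0, σ), 1)] : Fin 2 → SectorLeg 1) x‖ ≤ Mt)
    (hfit1 : 2 * Ms ≤ R.cz * |U| * (cDtmin (-1.2) (-0.05) / 2)) (hfit2 : 2 * Mt ≤ R.cz * |U|) :
    TwoLegSlopes L M R β U μ K n := by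
  have ha : (-4 : ℝ) < -1.2 := by norm_num
  have hab : (-1.2 : ℝ) ≤ -0.05 := by norm_num
  have hb : (-0.05 : ℝ) < 0 := by norm_num
  set B := bandBounds ha hab hb with hBdef
  have hBD : B.Dtmin = cDtmin (-1.2) (-0.05) := rfl
  have hβ : 0 < β := lt_of_lt_of_le (by unfold klBetaMin; norm_num) hβmin
  have hAf : ∀ p : Momentum, ∀ j ≤ 2, ‖iteratedFDeriv ℝ j (frameShift K) p‖ ≤
      2 * R.Gfr 0 * |U| + 2 * R.Gfr 1 * U ^ 2 + R.Gfr 2 * (c / Real.log 4) := fun p j hj =>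
    norm_iteratedFDeriv_frameShift_le_of_frameOK_regime hR hc.le hβmin hβc hK p hj
  obtain ⟨hA20, hADt', hhalf⟩ := two_frameSize_lt_cDtmin_wide hR hc.le hcle hU hUle
  set A := 2 * R.Gfr 0 * |U| + 2 * R.Gfr 1 * U ^ 2 + R.Gfr 2 * (c / Real.log 4) with hAdef
  have hADt : 2 * A < B.Dtmin := by rw [hBD]; exact hADt'
  obtain ⟨hloΛ, hhiΛ⟩ := klWindowC_shell_margin hμ hA20 (klScale_klE0_le_klE0 n)
  have hbS := norm_fderiv_evalM_twoLegPoly_le_of_position_moment hβ U μ K n hMs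
  have hczU : 0 ≤ R.cz * |U| := by
    by_contra hneg
    have hneg' : R.cz * |U| < 0 := lt_of_not_ge hneg
    have : R.cz * |U| * (cDtmin (-1.2) (-0.05) / 2) < 0 := mul_neg_of_neg_of_pos hneg' (by linarith [cDtmin_wide_ge])
    linarith
  have hb' : 2 * Ms ≤ R.cz * |U| * (B.Dtmin - 2 * A) := hfit1.trans (mul_le_mul_of_nonneg_left (by rw [hBD]; exact hhalf) hczU)
  refine twoLegSlopes_of_fieldStrength_of_gradient B hAf hADt hloΛ hhiΛ (selfEnergySymmetric_all L M β U μ K n) ?_ (by positivity) hbS hb'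
  intro k _
  exact (abs_klFieldStrength_sub_one_le_of_time_moment hβ U μ K n k hMt).trans hfit2

/-- **(E3c) for `ℓ_{n+1}`, increment-resolved, NAMED thresholds**, `D_lip = klCurveD`: gradient `b_Δ` of the increment, response modulus `ρ_Δ` against
every admissible `K′` with history, fit `ρ_Δ + b_Δ/klCurveD ≤ lipBar G Q U (n+1)` ⇒ `FrameLipschitzFnT … K (n+1)`. -/
theorem frameLipschitzFnT_succ_of_increment_responses_explicit {R : RenConsts} (hR : ∀ j, 0 ≤ R.Gfr j) {c : ℝ} (hc : 0 < c)
    (hcle : c ≤ klCurveC3 R) {U : ℝ} (hU : 0 < U) (hUle : U ≤ klCurveU0 R) {β : ℝ} (hβmin : klBetaMin ≤ β)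
    (hβc : β ≤ Real.exp (c / U ^ 2)) {μ : ℝ} (hμ : μ ∈ klWindowC) {K : TrigPolyC4v} (hK : FrameOK R U (nScales β) μ K)
    (hist : TrigPolyC4v → ℕ → Prop) (G : GeoConsts) (Q : EngConsts) (n : ℕ) {bΔ ρΔ : ℝ} (hbΔ : 0 ≤ bΔ)
    (hg : ∀ q : Momentum, ‖fderiv ℝ (fun q : Momentum =>
      evalM (symInterp L (klLocSelfEnergyRe L M β U μ K (n + 1))) q - evalM (symInterp L (klLocSelfEnergyRe L M β U μ K n)) q) q‖ ≤ bΔ)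
    (hr : ∀ K' : TrigPolyC4v, FrameOK R U (klTempScaleIdx β klE0) μ K' → (∀ j < n + 1, hist K' j) → ∀ θ : ℝ,
      |((symInterp L (klLocSelfEnergyRe L M β U μ K (n + 1))).eval (klFermiPoint μ K' θ) -
          (symInterp L (klLocSelfEnergyRe L M β U μ K n)).eval (klFermiPoint μ K' θ)) -
        ((symInterp L (klLocSelfEnergyRe L M β U μ K' (n + 1))).eval (klFermiPoint μ K' θ) -
          (symInterp L (klLocSelfEnergyRe L M β U μ K' n)).eval (klFermiPoint μ K' θ))| ≤ ρΔ * frameDist K K')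
    (hfit : ρΔ + bΔ / klCurveD ≤ lipBar G Q U (n + 1)) :
    FrameLipschitzFnT L M hist G Q R β U μ K (n + 1) := by
  intro K' hK' hhist q
  have ha : (-4 : ℝ) < -1.1 := by norm_num
  have hab : (-1.1 : ℝ) ≤ -0.1 := by norm_num
  have hb : (-0.1 : ℝ) < 0 := by norm_num
  obtain ⟨hAf, hA20, hADt, hhalf, ⟨hlo, hhi⟩, -, -⟩ := frame_sizes_of_frameOK_explicit hR hc hcle hU hUle hβmin hβc hμ hK
  obtain ⟨hAf', -, -, -, -, -, -⟩ := frame_sizes_of_frameOK_explicit hR hc hcle hU hUle hβmin hβc hμ hK'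
  set A := 2 * R.Gfr 0 * |U| + 2 * R.Gfr 1 * U ^ 2 + R.Gfr 2 * (c / Real.log 4) with hAdef
  have hA0 : 0 ≤ A := le_trans (norm_nonneg _) (hAf 0 0 (by norm_num))
  have hbd := abs_klTwoLegPieceFn_eval_succ_sub_le_sharp (bandBounds ha hab hb) hAf hAf' hADt hlo hhi hbΔ hg (hr K' hK' hhist) q
  have hfd : 0 ≤ frameDist K K' := frameDist_nonneg K K'
  have hDpos : 0 < klCurveD := by unfold klCurveD; linarith [cDtmin_window_ge]
  have hden : frameDist K K' / ((bandBounds ha hab hb).Dtmin - A) ≤ frameDist K K' / klCurveD :=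
    div_le_div_of_nonneg_left hfd hDpos (by linarith)
  have h1 : ρΔ * frameDist K K' + bΔ * (frameDist K K' / klCurveD) = (ρΔ + bΔ / klCurveD) * frameDist K K' := by ring
  calc _ ≤ ρΔ * frameDist K K' + bΔ * (frameDist K K' / ((bandBounds ha hab hb).Dtmin - A)) := hbd
    _ ≤ ρΔ * frameDist K K' + bΔ * (frameDist K K' / klCurveD) := by nlinarith [mul_le_mul_of_nonneg_left hden hbΔ]
    _ = (ρΔ + bΔ / klCurveD) * frameDist K K' := h1
    _ ≤ lipBar G Q U (n + 1) * frameDist K K' := mul_le_mul_of_nonneg_right hfit hfd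

/-- **(E3c) for `ℓ_0`, NAMED thresholds**, `D_lip = klCurveD`: gradient `b₀` of `evalM S_0^K − evalM K`, response modulus `ρ₀` of `T^K = S_0^K − K`
against every admissible `K′`, fit `ρ₀ + b₀/klCurveD ≤ lipBar G Q U 0` ⇒ `FrameLipschitzFnT … K 0`. -/
theorem frameLipschitzFnT_zero_of_responses_explicit {R : RenConsts} (hR : ∀ j, 0 ≤ R.Gfr j) {c : ℝ} (hc : 0 < c)
    (hcle : c ≤ klCurveC3 R) {U : ℝ} (hU : 0 < U) (hUle : U ≤ klCurveU0 R) {β : ℝ} (hβmin : klBetaMin ≤ β)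
    (hβc : β ≤ Real.exp (c / U ^ 2)) {μ : ℝ} (hμ : μ ∈ klWindowC) {K : TrigPolyC4v} (hK : FrameOK R U (nScales β) μ K)
    (hist : TrigPolyC4v → ℕ → Prop) (G : GeoConsts) (Q : EngConsts) {b₀ ρ₀ : ℝ} (hb₀ : 0 ≤ b₀)
    (hg₀ : ∀ q : Momentum, ‖fderiv ℝ (fun q : Momentum =>
      evalM (symInterp L (klLocSelfEnergyRe L M β U μ K 0)) q - evalM K q) q‖ ≤ b₀)
    (hr₀ : ∀ K' : TrigPolyC4v, FrameOK R U (klTempScaleIdx β klE0) μ K' → ∀ θ : ℝ,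
      |((symInterp L (klLocSelfEnergyRe L M β U μ K 0)).eval (klFermiPoint μ K' θ) - K.eval (klFermiPoint μ K' θ)) -
        ((symInterp L (klLocSelfEnergyRe L M β U μ K' 0)).eval (klFermiPoint μ K' θ) - K'.eval (klFermiPoint μ K' θ))| ≤
        ρ₀ * frameDist K K')
    (hfit : ρ₀ + b₀ / klCurveD ≤ lipBar G Q U 0) :
    FrameLipschitzFnT L M hist G Q R β U μ K 0 := by
  intro K' hK' _ q
  have ha : (-4 : ℝ) < -1.1 := by norm_num
  have hab : (-1.1 : ℝ) ≤ -0.1 := by norm_num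
  have hb : (-0.1 : ℝ) < 0 := by norm_num
  obtain ⟨hAf, hA20, hADt, hhalf, ⟨hlo, hhi⟩, -, -⟩ := frame_sizes_of_frameOK_explicit hR hc hcle hU hUle hβmin hβc hμ hK
  obtain ⟨hAf', -, -, -, -, -, -⟩ := frame_sizes_of_frameOK_explicit hR hc hcle hU hUle hβmin hβc hμ hK'
  set A := 2 * R.Gfr 0 * |U| + 2 * R.Gfr 1 * U ^ 2 + R.Gfr 2 * (c / Real.log 4) with hAdef
  have hA0 : 0 ≤ A := le_trans (norm_nonneg _) (hAf 0 0 (by norm_num))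
  have hbd := abs_klTwoLegPieceFn_eval_zero_sub_le_sharp (bandBounds ha hab hb) hAf hAf' hADt hlo hhi hb₀ hg₀ (hr₀ K' hK') q
  have hfd : 0 ≤ frameDist K K' := frameDist_nonneg K K'
  have hDpos : 0 < klCurveD := by unfold klCurveD; linarith [cDtmin_window_ge]
  have hden : frameDist K K' / ((bandBounds ha hab hb).Dtmin - A) ≤ frameDist K K' / klCurveD :=
    div_le_div_of_nonneg_left hfd hDpos (by linarith)
  have h1 : ρ₀ * frameDist K K' + b₀ * (frameDist K K' / klCurveD) = (ρ₀ + b₀ / klCurveD) * frameDist K K' := by ring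
  calc _ ≤ ρ₀ * frameDist K K' + b₀ * (frameDist K K' / ((bandBounds ha hab hb).Dtmin - A)) := hbd
    _ ≤ ρ₀ * frameDist K K' + b₀ * (frameDist K K' / klCurveD) := by nlinarith [mul_le_mul_of_nonneg_left hden hb₀]
    _ = (ρ₀ + b₀ / klCurveD) * frameDist K K' := h1
    _ ≤ lipBar G Q U 0 * frameDist K K' := mul_le_mul_of_nonneg_right hfit hfd

end Model

end Summit.HubbardSuperconductivity.HubbardSuperconductivity.Theorems.KLRegimeSplit

end
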